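import Summits.QuantumFields.BalabanUV.T4Continuum.Spine.NE1p.DressedSmallFieldFamiliesWitness
import Summits.QuantumFields.BalabanUV.T4Continuum.Spine.NE1p.DressedSmallFieldFamilyAmplitude

/-!
# T⁴ programme, spine estimate NE1′ (node O3b/H2) — WITNESS W45, PART 2 «THE μ-TWIN FIRES ON THE SAME DATUM»: the owner's source-pencil
# families END `muPart_locE_le_of_coresAt_pencil_families` (`Spine/NE1p/DressedSmallFieldFamilyAmplitude`, N0t — "the source-pencil twin of N0s §4,
# which N0s leaves to the reader") APPLIED ONCE BY NAME — a DECIDED applier (wording of typer R-T125: no «first» beyond the landing order the journal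
# records) — on W45's covering-family datum read along the SOURCE pencil

Cell `pub-balaban`, sub-cell `t4`, row NE1′ formalisation crew (`t4/formal/NE1p/LEAVES.md` row W48 ∕ DAG N29zzp — W45's μ-twin follow-up; INTENT
HOME/CLAIMS.log l.19325, BOOKED typer R-T125 l.19575, X161 its read),
unit `b2b-balaban-t4-ne1p-formalise-leaf-10` (gen 10).  ADDITIVE — imports THIS LINEAGE's W45 `Spine/NE1p/DressedSmallFieldFamiliesWitness` (→ N0s, W41,
W35, W33, W24) and the owner's N0t `Spine/NE1p/DressedSmallFieldFamilyAmplitude` (→ N0s) ONLY; THEOREMS ONLY (0 def, 0 `def … : Prop`, 0 cite, 0 sorry,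
0 `attribute`); nothing of W45 ∕ N0t ∕ N0s ∕ W41 ∕ W35 ∕ W33 ∕ W24 is restated — `cF`, `pF`, `GF`, `actF`, `termsF`, `actF_X₀`, `pF_pos`, `pF_le_one`, `hκ_F`,
`h229_F`, `α₆F_pos`, `cF_pos`, `norm_actF_X₀_lt_one`, `budget_half`, `letterMass_coreW`, `N₁_coreW`, `closedForm_real_sub_zero`, `integral_incr_pos`,
`hsmall_mu`, `exp_locE_cube`, `hrate_torus`, `ctr0`, `hroom0`, `torus_consts`, `K₀_four` are used BY NAME.

WHY.  W45 fired N0s §4's families END along the TABLE-STRENGTH pencil (`act 1` vs `act 0`).  N0t adds the SOURCE-pencil twin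
`muPart_locE_le_of_coresAt_pencil_families`: the observable's table contribution `v` scaled by the source `s` enters ONLY the per-family amplitude
(radius `‖h₀‖ + μ₁‖v‖`), the count is μ-free; for `0 < μ₀ < μ₁`, `‖sμ‖ ≤ μ₀` the μ-part is `≤ (e ν c₁ K₀²·A·e^{−r₁ d})·μ₀∕(μ₁ − μ₀)`.  Here W45's datum (`GF`, `termsF`, `actF` — the SAME activity, its pencil `s ↦ 0 + s • liveTable` read with `v := liveTable`) meets
its binders: `hAmp_Fmu` (amplitude at the radius `‖0‖ + μ₁‖liveTable‖`, `μ₁ ≤ 2`, constant `A := Acst∕2`, W41's `budget_half`), `hsmall_Fmu`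
(½·W35's `hsmall_mu`); **`familiesMuEnd_fires`** (N0t ONCE BY NAME, `D = Dk := tsys 4 N`, `G = Gk := tgeometry 4 N`, `foot := id`, W45's clauses
`hκ_F`∕`h229_F`, `hterms` by `Finset.Subset.refl`), closed form `≤ (K₀(64,8)∕2)·μ₀∕(μ₁ − μ₀)`; GENUINE **`actF_mu_live`** (at every REAL source
`0 < t` the increment is `cF{X₀}·∫ incr (t·r) > 0`) and **`familiesMuEnd_live`** (`0 < t ≤ 2`; W24's `exp_locE_cube`).

WORDING OF RECORD: W45's (typer R-T124 (iv)) — «(B3-amp) MET because the weights are CHOSEN as the (2.28)-shaped product — UNPRINTED for Bałaban's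
cores (G-ne9p2-5); (B3-count) is N0s §2's kernel count of b13's PROVED (2.29) on pv22's torus; `foot = id` and ‘all covering families’ are OUR toy
choices» — now for the source pencil; `μ₀`, `μ₁` symbolic with `μ₁ ≤ 2` (NE5's class radius), nothing about print's μ-window (w6).

HONEST FRAMING.  A DECIDED TOY ([folklore]; 0 sorry; 0 citations; no `def`).  The cores are THEOREM-backed instances of the cell's typed FORMAT of (2.14)
over row NE5's TOY frame — NOT Bałaban's (2.14) terms; (B1b) NOT claimed; (B3-amp) MET by CHOSEN weights — UNPRINTED for Bałaban's cores (G-ne9p2-5);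
0 binders instantiated on Bałaban's densities; no wall item; wall v1.7 (T4-DAG v44) does NOT move; R-t4r2-Q2 NOT met thereby; NE1′ ⇐ the named binders —
NOT proved, NOT printed; spine PROVED 0∕9; count 9 unchanged.  Rung (B)+1 on ONE finite four-torus — NOT infinite volume, NOT a mass gap, NOT OS on ℝ⁴,
NOT Clay.  HONEST DEPENDENCY: continuum YM on T⁴ ⇐ BetaPertH ∧ nine spine estimates (0/9 proved); BetaPertH ⇐ (D1) ∧ (D4) ∧ CAP+tail; G-an2-4
gates asym, D1 and NE2/3/4.
-/

noncomputable section

namespace Summit.QuantumFields.BalabanUV.T4Continuum.NE1p.DressedSmallFieldFamiliesWitness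

open Set Metric MeasureTheory Complex
open scoped BigOperators
open Literature.MathematicalPhysics.QuantumFieldTheory.Balaban1983to89
open Literature.MathematicalPhysics.QuantumFieldTheory.Balaban1983to89.B12TreeDecay (K₀ K₀_pos)
open Literature.MathematicalPhysics.QuantumFieldTheory.Balaban1983to89.B13Resummation (locE)
open Literature.MathematicalPhysics.QuantumFieldTheory.Balaban1983to89.TreeLengthTorus (TDom tsys)
open Literature.MathematicalPhysics.QuantumFieldTheory.Balaban1983to89.TreeLengthTorusGeometry (tgeometry TTouch)
open Summit.QuantumFields.BalabanUV.T4Continuum.B13HistMeasurable (B13HistM)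
open Summit.QuantumFields.BalabanUV.T4Continuum.B13HistWitness (toyFrame)
open Summit.QuantumFields.BalabanUV.T4Continuum.NE1p.DressedSmallFieldTorusWitness (X₀ hrate_torus exp_locE_cube)
open Summit.QuantumFields.BalabanUV.T4Continuum.NE1p.DressedSmallFieldGeometry (torus_consts)
open Summit.QuantumFields.BalabanUV.T4Continuum.NE1p.DressedSmallFieldGeometryFaces (K₀_four)
open Summit.QuantumFields.BalabanUV.T4Continuum.NE1p.DressedSmallFieldCoresWitness (E1 liveTable norm_liveTable_le coreW N₁_coreW ctr0 hroom0 Acst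
  Acst_pos incr integral_incr_pos)
open Summit.QuantumFields.BalabanUV.T4Continuum.NE1p.DressedSmallFieldCoresMassWitness (letterMass_coreW cM hsmall_mu)
open Summit.QuantumFields.BalabanUV.T4Continuum.NE1p.DressedSmallFieldDepCoresWitness (budget_half closedForm_real_sub_zero)
open Summit.QuantumFields.BalabanUV.T4Continuum.NE1p.DressedSmallFieldFamilyAmplitude (muPart_locE_le_of_coresAt_pencil_families)

section Torus
variable (N : ℕ) [NeZero N] (r : ℝ) (hr : 0 ≤ r)

/-! ## §1 The source-pencil amplitude clause and the «ε small» clause at `A := A∕2` -/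

/-- **`hAmp` ALONG THE SOURCE PENCIL** (`h₀ = 0`, `v = liveTable`, `‖s‖ < μ₁ ≤ 2`, constant `A := Acst∕2`) [decided toy], in the LITERAL binder shape
of N0t's μ-families END at NE5's toy letters `(mq, bq, N₀) = (1, 0, 1)`: `pF Df·|cM r∕2|·√(2π)·e^{r·μ₁‖liveTable‖} ≤ pF Df·A∕2 = (A∕2)·pF Df`
(W35 `letterMass_coreW`, W33 `N₁_coreW`, W41 `budget_half` with `u = μ₁‖liveTable‖ ≤ 2`). [folklore] -/
theorem hAmp_Fmu {μ₁ : ℝ} (hμ₁ : μ₁ ≤ 2) (k : ℕ) :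
    ∀ Z : (tsys 4 N).Dom, (tgeometry 4 N).cubes Z ⊆ (tgeometry 4 N).cubes (X₀ N) → ∀ Df ∈ termsF N Z,
      (GF N r hr k Df k).lam.real univ *
          ((GF N r hr k Df k).wB * (fun (_ : ℕ) (_ : Finset (TDom 4 N)) (_ : ℕ) => (1 : ℝ)) k Df k *
            Real.exp ((fun (_ : ℕ) (_ : Finset (TDom 4 N)) (_ : ℕ) => (0 : ℝ)) k Df k)) *
          (Real.pi / ((fun (_ : ℕ) (_ : Finset (TDom 4 N)) (_ : ℕ) => (1 : ℝ)) k Df k / 2)) ^ (Module.finrank ℝ E1 / 2 : ℝ) *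
        Real.exp ((GF N r hr k Df k).N₁ * (‖(0 : B13HistM toyFrame)‖ + μ₁ * ‖liveTable‖)) ≤
      (Acst / 2) * pF N Df := by
  intro Z _ Df _
  simp only [GF_apply]
  rw [letterMass_coreW, N₁_coreW, norm_zero, zero_add]
  have hp : 0 ≤ pF N Df := (pF_pos N Df).le
  have hT : μ₁ * ‖liveTable‖ ≤ 2 :=
    (mul_le_mul hμ₁ norm_liveTable_le (norm_nonneg _) (by norm_num)).trans (by norm_num)
  have hb := budget_half r hr hT
  unfold cF
  rw [abs_mul, abs_of_nonneg hp]
  calc |cM r / 2| * pF N Df * Real.sqrt (2 * Real.pi) * Real.exp (r * (μ₁ * ‖liveTable‖))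
      = pF N Df * (|cM r / 2| * Real.sqrt (2 * Real.pi) * Real.exp (r * (μ₁ * ‖liveTable‖))) := by ring
    _ ≤ pF N Df * (Acst / 2) := mul_le_mul_of_nonneg_left hb hp
    _ = Acst / 2 * pF N Df := by ring

/-- The «ε small» clause at the constant `A∕2`: half of W35's `hsmall_mu`. [arith] -/
theorem hsmall_Fmu : Acst / 2 * Real.exp (0 + 1) * (tgeometry 4 N).K₀ * (tgeometry 4 N).ν * (tgeometry 4 N).c₁ ≤ 1 := by
  have h := hsmall_mu N
  calc Acst / 2 * Real.exp (0 + 1) * (tgeometry 4 N).K₀ * (tgeometry 4 N).ν * (tgeometry 4 N).c₁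
      = (1 / 2) * (Acst * Real.exp (0 + 1) * (tgeometry 4 N).K₀ * (tgeometry 4 N).ν * (tgeometry 4 N).c₁) := by ring
    _ ≤ (1 / 2) * 1 := by gcongr
    _ ≤ 1 := by norm_num

/-! ## §2 THE μ-TWIN FIRES: N0t's source-pencil families END applied ONCE BY NAME (a decided applier) -/

open Classical in
/-- **N0t's `muPart_locE_le_of_coresAt_pencil_families` FIRES ON W45's DATUM** [decided toy]: the SAME activity `actF` read along the SOURCE pencil
`s ↦ 0 + s • liveTable` (`h₀ := 0`, `v := liveTable`, `‖s‖ < μ₁ ≤ 2` so the pencil stays in NE5's class of history radius `2`), `hAmp_Fmu` at `A := A∕2`,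
`hsmall_Fmu`, W45's clauses `hκ_F`∕`h229_F`, `foot := id`, `hmono := le_rfl`, `hterms := Finset.Subset.refl`, W33's `ctr0`∕`hroom0`, NE5's toy letters
INLINE, W24's `hrate_torus`; for `0 < μ₀ < μ₁`, `‖μ‖ ≤ μ₀`.  Conclusion LITERAL. [folklore] -/
theorem familiesMuEnd_fires {μ₁ μ₀ : ℝ} {μ : ℂ} (hμ₁ : μ₁ ≤ 2) (h0 : 0 < μ₀) (h01 : μ₀ < μ₁) (hμ : ‖μ‖ ≤ μ₀) (k : ℕ) :
    ‖locE (tgeometry 4 N).ι (tgeometry 4 N).cubes (actF N r hr k μ) ((tgeometry 4 N).cubes (X₀ N)) -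
        locE (tgeometry 4 N).ι (tgeometry 4 N).cubes (actF N r hr k 0) ((tgeometry 4 N).cubes (X₀ N))‖ ≤
      Real.exp 1 * (tgeometry 4 N).ν * (tgeometry 4 N).c₁ * (tgeometry 4 N).K₀ ^ 2 * (Acst / 2) *
        Real.exp (-(0 * (tsys 4 N).dj (X₀ N))) * (μ₀ / (μ₁ - μ₀)) :=
  muPart_locE_le_of_coresAt_pencil_families (tsys 4 N) (tgeometry 4 N) (tgeometry 4 N) (GF N r hr)
    (W := Set.univ) (ctr := ctr0) (ROp := fun _ => 1) (RHist := fun _ => 2) (R' := fun _ => 2)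
    (mq := fun _ _ _ => 1) (bq := fun _ _ _ => 0) (N₀ := fun _ _ _ => 1)
    hroom0 (fun _ _ _ _ _ _ _ => one_pos)
    (fun _ _ _ _ _ _ _ => ⟨fun _ _ => aestronglyMeasurable_const, fun _ => differentiableOn_const _, fun _ _ _ => by
      show ‖(1 : ℂ)‖ ≤ 1; rw [norm_one]⟩)
    (fun _ _ _ _ _ _ _ => ⟨fun _ _ => (Complex.measurable_ofReal.comp (measurable_snd.norm.pow_const 2)).aestronglyMeasurable,
      fun _ _ => differentiableOn_const _, fun _ _ _ v => by
        show 1 * ‖v‖ ^ 2 - 0 ≤ (((‖v‖ ^ 2 : ℝ) : ℂ)).re; rw [Complex.ofReal_re]; simp⟩)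
    (g := fun _ => 0) (Set.mem_univ _) (U := ()) (o := 0) (h₀ := 0) (v := liveTable) (μ₁ := μ₁)
    (by show ‖(0 : ℂ) - 0‖ ≤ 1; simp)
    (by show ‖(0 : B13HistM toyFrame) - 0‖ + μ₁ * ‖liveTable‖ ≤ 2; rw [sub_zero, norm_zero, zero_add];
        exact (mul_le_mul hμ₁ norm_liveTable_le (norm_nonneg _) (by norm_num)).trans (by norm_num))
    (emb := fun _ => k) (fun _ => rfl) (terms := termsF N) (act := actF N r hr k) (fun _ _ _ => rfl)
    (A := Acst / 2) (R := 2 * (tgeometry 4 N).κ₀ + 2) (r₁ := 0) (b₅ := 0) (X₀ := X₀ N)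
    (by have := Acst_pos; positivity) le_rfl (by norm_num) (hrate_torus N) (hsmall_Fmu N)
    (fun Z => Z) (fun _ => le_rfl) (δ := δF) (κ := κF) (α₆ := α₆F) α₆F_pos.le (hκ_F N) (h229_F N)
    (fun _ => Finset.Subset.refl _) (hAmp_Fmu N r hr hμ₁ k) h0 h01 hμ

open Classical in
/-- … in CLOSED FORM: the μ-part is `≤ (K₀(64,8)∕2)·μ₀∕(μ₁ − μ₀)` (pv22's constants by `torus_consts`∕`K₀_four` BY NAME). [folklore] -/
theorem familiesMuEnd_fires_closed {μ₁ μ₀ : ℝ} {μ : ℂ} (hμ₁ : μ₁ ≤ 2) (h0 : 0 < μ₀) (h01 : μ₀ < μ₁) (hμ : ‖μ‖ ≤ μ₀) (k : ℕ) :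
    ‖locE (tgeometry 4 N).ι (tgeometry 4 N).cubes (actF N r hr k μ) ((tgeometry 4 N).cubes (X₀ N)) -
        locE (tgeometry 4 N).ι (tgeometry 4 N).cubes (actF N r hr k 0) ((tgeometry 4 N).cubes (X₀ N))‖ ≤
      K₀ 64 8 / 2 * (μ₀ / (μ₁ - μ₀)) := by
  refine (familiesMuEnd_fires N r hr hμ₁ h0 h01 hμ k).trans (le_of_eq ?_)
  rw [(torus_consts N).1, (torus_consts N).2.2, K₀_four, zero_mul, neg_zero, Real.exp_zero, mul_one]
  unfold Acst
  have hK := K₀_pos (64 : ℝ) 8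
  have he := Real.exp_pos 1
  field_simp

/-! ## §3 GENUINE: the μ-part of the activity at a REAL positive source is NOT zero -/

/-- **THE μ-PART AT A REAL POSITIVE SOURCE IS NOT ZERO** [decided toy]: `actF t X₀ − actF 0 X₀ = cF{X₀}·∫ incr (t·r)` (W45's `actF_real_sub_zero`)
with `cF{X₀} > 0` and `∫ incr (t·r) > 0` for `0 < t`, `0 < r` (W33's `integral_incr_pos`). [folklore] -/
theorem actF_mu_live (hr0 : 0 < r) {t : ℝ} (ht : 0 < t) (k : ℕ) : actF N r hr k (t : ℂ) (X₀ N) ≠ actF N r hr k 0 (X₀ N) := by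
  intro h
  have h0 := sub_eq_zero.2 h
  rw [actF_real_sub_zero] at h0
  rcases mul_eq_zero.1 h0 with hc | hI
  · exact (cF_pos N r {X₀ N}).ne' (by exact_mod_cast hc)
  · exact (integral_incr_pos (t * r) (mul_pos ht hr0)).ne' (by exact_mod_cast hI)

open Classical in
/-- **THE μ-END's BOUNDED QUANTITY IS NOT ZERO** for a REAL source `0 < t ≤ 2` [decided toy]: equal dressed outputs on the cube would give equal
activities at `X₀` (W24's `exp_locE_cube` BY NAME; W45's `norm_actF_X₀_lt_one` for `‖t‖ ≤ 2`), contradicting `actF_mu_live`. [folklore] -/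
theorem familiesMuEnd_live (hr0 : 0 < r) {t : ℝ} (ht : 0 < t) (ht2 : t ≤ 2) (k : ℕ) :
    locE (tgeometry 4 N).ι (tgeometry 4 N).cubes (actF N r hr k (t : ℂ)) ((tgeometry 4 N).cubes (X₀ N)) ≠
      locE (tgeometry 4 N).ι (tgeometry 4 N).cubes (actF N r hr k 0) ((tgeometry 4 N).cubes (X₀ N)) := by
  intro h
  have ht' : ‖(t : ℂ)‖ ≤ 2 := by rw [Complex.norm_real, Real.norm_eq_abs, abs_of_pos ht]; exact ht2
  have h1 := exp_locE_cube N (w := actF N r hr k (t : ℂ)) (norm_actF_X₀_lt_one N r hr k ht')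
  have h0 := exp_locE_cube N (w := actF N r hr k 0) (norm_actF_X₀_lt_one N r hr k (by simp))
  have h' : cexp (locE (TTouch (d := 4) (N := N)) (fun Z : (tsys 4 N).Dom => Z.1) (actF N r hr k (t : ℂ)) {0}) =
      cexp (locE (TTouch (d := 4) (N := N)) (fun Z : (tsys 4 N).Dom => Z.1) (actF N r hr k 0) {0}) := congrArg cexp h
  rw [h1, h0, add_right_inj] at h'
  exact actF_mu_live N r hr hr0 ht k h'

/-- SANITY: the table-strength END of W45 is the `t = 1` instance of the source-pencil liveness. -/
example (hr0 : 0 < r) (k : ℕ) : actF N r hr k 1 (X₀ N) ≠ actF N r hr k 0 (X₀ N) := by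
  simpa using actF_mu_live N r hr hr0 one_pos k

end Torus

end Summit.QuantumFields.BalabanUV.T4Continuum.NE1p.DressedSmallFieldFamiliesWitness

end
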